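/-
Copyright: the b2b-balaban T⁴-continuum CRUX team, row NE7b OWNER lineage `t4-ne7b-p1` (gen 120). Project licence.
-/
import Summits.QuantumFields.BalabanUV.T4Continuum.Spine.NE7b.SupTorusActionForm

/-!
# THE SCHUR COMPLEMENT `T = Q′t H⁻¹ Q′t*` OF THE TORUS HESSIAN IS SYMMETRIC AND EXPONENTIALLY LOCAL ON THE COARSE TORUS, MESH-FREE —
# `|T(y,y′)| ≤ m_κ⁻¹e^{2dκ}e^{−κρ_s(y,y′)}` for `H = (n+1)²(−Δ) + a(n+1)^{−d}(block sums) + V`, ANY `V ≥ −λ`, every mesh `n`, every period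
# `s` — AND, GIVEN THE COARSE FLOOR `T ≥ γ` ([B6] (2.76)'s torus twin, a hypothesis), ITS INVERSE IS EXPONENTIALLY LOCAL WITH
# CONSTANTS DEPENDING ON `(d, a, λ, κ, γ)` ONLY: the next-scale Hessian `W″ = (n+1)^d T⁻¹` of the road is local uniformly in the field,
# the mesh and the volume, modulo the floor (row NE7b, node U5c; (130)–(132) + `B4Sect5Torus.sect5Uniform_holds` BY NAME; [folklore])

Cell `pub-balaban`, sub-cell `t4`, spine estimate NE7b (`T4WeightBudget.RelWeightBound`; the cell's OWN estimate — NOT PRINTED in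
[Bałaban 1983–89], NOT PROVED).  Crux-route work under `Spine/NE7b/` by the row OWNER (`t4-ne7b-p1` gen 120, file (134)) under FREEZE
(0)'s crux-prover clause — the coarse half of the locality column begun in (130); NOTHING of Bałaban's is named as a Lean object, valued
or asserted; no `T4Continuum/Support` leaf typed; no `def`, no notation (the block columns `ψ_{y′}` of `H⁻¹` enter through the displayed
equation `Hψ_{y′} = 𝟙[bt · = y′]`, the Schur complement is WRITTEN OUT as `(n+1)^{−d}Σ_z ψ_{y′}(σ(chart n (wm y) z))`, its matrix is
Mathlib's `Matrix.of` of that expression); zero `sorry`.  Imports (BY NAME): the OWNER's (133) `…SupTorusActionForm` (`action_form_symm`, `sum_indicator_mul`, `block_sum_le_total`,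
`weight_on_block`; through it (131) `inverseHessian_weighted_resolvent`, (132) `torusDist_bond_lipschitz`, `isPseudoDist_torus` and
`coarse_inverse_decay` = [Balaban1983RegularityDecay] Sect. 5 Theorem, tree-proved, read on tori).

WHY (located).  The road's constrained objects are Schur complements of the UNCONSTRAINED Hessian `H`: the response is
`DΦ(w)k = H⁻¹Q′t*(Q′tH⁻¹Q′t*)⁻¹k`, the next-scale Hessian is `W″(w) = (n+1)^d (Q′tH⁻¹Q′t*)⁻¹` ((100)∕(102)), the fluctuation covariance is
`H⁻¹ − H⁻¹Q′t*(Q′tH⁻¹Q′t*)⁻¹Q′tH⁻¹`.  (131) localised `H⁻¹` in the weighted `ℓ²` currency; this file passes to the COARSE operator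
`T = Q′tH⁻¹Q′t*` WITHOUT the `ℓ² → ℓ^∞` loss: the block `ℓ²`-norm of the column `ψ_{y′} = H⁻¹𝟙_{B_{y′}}` over the block `y` is
`≤ m_κ⁻¹(n+1)^{d∕2}e^{2dκ}e^{−κρ_s(y,y′)}` ((131) with the weight `(κ∕(n+1))·ρ_N(·, corner of y′)` and (132)'s fine∕coarse comparison),
and block Cauchy–Schwarz turns the block SUM into `(n+1)^d ×` the same — exactly the normalisation `(n+1)^{−d}` of `Q′t`: `T` is `O(1)`
and local with mesh-free constants.  Symmetry of `T` is the symmetry of the form of `H` (polarised torus summation by parts).  The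
inverse: `T` symmetric + local + the FLOOR `T ≥ γ` is `B4Sect5Torus.Hyp56` on the coarse torus with (132)'s `ℓ¹` circular distance, and
(132) `coarse_inverse_decay` (= the tree's proof of B4's Sect. 5 Theorem) gives `|T⁻¹(y,y′)| ≤ c₁e^{−δ₁ρ_s}` with `(c₁, δ₁)` chosen BEFORE
`n, s, V`.  The floor itself — `⟨g, Tg⟩ ≥ γΣg²` mesh-free, i.e. `⟨G, H⁻¹G⟩ ≥ γ(n+1)^{−d}... ` for block-constant `G` — is [B6] (2.76)'s
content (bump test functions; `B6QGQLower276` proves the free `ℤ^d` case); its torus-with-potential twin is NOT typed here (hypothesis).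

WHAT IS PROVED ([folklore]; fine torus `Site d ((n+1)s)`, coarse `Site d s`, `[NeZero s]`; `(Hu)(x)` the displayed action with `V`;
`bt x = σ_s(blk n (wm x))`; `m_κ = min(2,a) − λ − 2dκ² − a(e^{2dκ} − 1)`; `ρ_s` = (132)'s `ℓ¹` circular distance, written out):
* §1 (columns `Hψ_{y′} = 𝟙[bt · = y′]`) **`schur_symm`** (`T(y,y′) = T(y′,y)`), **`schur_column_sq_le`**
  (`Σ_z ψ_{y′}(σ(chart (wm y) z))² ≤ m_κ⁻²(n+1)^d e^{4dκ}e^{−2κρ_s(y,y′)}`), **`schur_entry_le`** (`|T(y,y′)| ≤ m_κ⁻¹e^{2dκ}e^{−κρ_s(y,y′)}`).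
* §2 **`schur_inverse_decay`** (THE END: `∃ c₁ δ₁ > 0` depending on `(d, a, λ, κ, γ)` only; for ALL `n, s, V ≥ −λ, ψ` as above WITH the
  floor `γΣg² ≤ Σ_y g y (Tg) y`: `|T⁻¹(y,y′)| ≤ c₁e^{−δ₁ρ_s(y,y′)}`, `T⁻¹` = Mathlib's `Matrix.inv` of `Matrix.of T`).
* §3 toy.

HONEST (what this is NOT).  The COARSE FLOOR is a hypothesis (located: [B6] (2.76)'s torus twin with potential — the bump argument of
`B6QGQLower276` §6–§7 transplanted; not here); existence of the columns `ψ_{y′}` is not re-proved here (coercivity ⟹ `H` bijective —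
(100)∕(106)'s solves; this file takes `ψ` with its displayed equation); the response and the covariance are the sequel; constants
explicit but not sharp; cubic periods; scalar skeleton ((A3), NC-NE7b-α UNRULED); nothing of the covariant propagators; nothing of
Bałaban's asserted ([B4] Sect. 5 is the tree's PROVED theorem, used by name).  BY-NAME EFFECT ON THE WALL: NONE.  NE7b NOT PRINTED ∕ NOT
PROVED; spine PROVED 0∕9; rung (B)+1 on a FINITE torus — NOT infinite volume, NOT the mass gap, NOT Clay.  HONEST DEPENDENCY: continuum
YM on T⁴ ⇐ BetaPertH ∧ nine spine estimates (0∕9 proved); BetaPertH ⇐ (D1) ∧ (D4) ∧ CAP+tail; G-an2-4 gates asym, D1 and NE2∕3∕4.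
-/

set_option autoImplicit false

noncomputable section

namespace Summit.QuantumFields.BalabanUV.T4Continuum.NE7b.SupTorusSchurComplement

open Real
open Literature.MathematicalPhysics.QuantumFieldTheory.Balaban1983to89
open B6QGQLower276 (X e blk B side chart mem_B sum_B sum_B_const card_cube blk_chart)
open Beta (Site siteOf windowMap siteOf_windowMap siteOf_add)
open SupTorusHessianCombesThomas (inverseHessian_weighted_resolvent)
open SupTorusBlockDistance (torusDist_bond_lipschitz fine_coarse_compare coarse_inverse_decay)
open SupTorusActionForm (action_form_symm sum_indicator_mul block_sum_le_total weight_on_block)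

variable {d : ℕ}

/-! ## §1. The Schur complement `T(y,y′) = (n+1)^{−d}Σ_z ψ_{y′}(σ(chart (wm y) z))`, `Hψ_{y′} = 𝟙[bt · = y′]`: symmetric, local -/

section Schur

variable (n : ℕ) (a : ℝ) (s : ℕ) [NeZero s] (ha : 0 ≤ a) {lam κ : ℝ} (hκ0 : 0 ≤ κ) (hκ1 : κ ≤ 1)
  (hm : 0 < min 2 a - lam - 2 * d * κ ^ 2 - a * (exp (2 * d * κ) - 1))
  (V : Site d ((n + 1) * s) → ℝ) (hV : ∀ x, -lam ≤ V x)
  (ψ : Site d s → Site d ((n + 1) * s) → ℝ)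
  (hψ : ∀ y' x, ((n : ℝ) + 1) ^ 2 * ∑ μ, (2 * ψ y' x - ψ y' (x + siteOf d ((n + 1) * s) (e μ)) - ψ y' (x - siteOf d ((n + 1) * s) (e μ)))
      + a / ((n : ℝ) + 1) ^ d * ∑ q ∈ B n (blk n (windowMap d ((n + 1) * s) x)), ψ y' (siteOf d ((n + 1) * s) q) + V x * ψ y' x
      = if siteOf d s (blk n (windowMap d ((n + 1) * s) x)) = y' then 1 else 0)

include hψ in
/-- **THE SCHUR COMPLEMENT IS SYMMETRIC**: with `ψ_{y′}` the solution of `Hψ_{y′} = 𝟙[bt · = y′]` (the columns of `H⁻¹` summed over a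
block), `T(y,y′) := (n+1)^{−d}Σ_z ψ_{y′}(σ(chart n (wm y) z))` satisfies `T(y,y′) = T(y′,y)` — both are `(n+1)^{−d}⟨ψ_y, Hψ_{y′}⟩` and the
form of `H` is symmetric. [folklore] -/
theorem schur_symm (y y' : Site d s) :
    (((n : ℝ) + 1) ^ d)⁻¹ * ∑ z : Fin d → Fin (n + 1), ψ y' (siteOf d ((n + 1) * s) (chart n (windowMap d s y) z))
      = (((n : ℝ) + 1) ^ d)⁻¹ * ∑ z : Fin d → Fin (n + 1), ψ y (siteOf d ((n + 1) * s) (chart n (windowMap d s y') z)) := by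
  congr 1
  rw [← sum_indicator_mul n s y (ψ y'), ← sum_indicator_mul n s y' (ψ y)]
  have h := action_form_symm n a s V (ψ y) (ψ y')
  simp only [hψ] at h
  -- `h : Σ_x ψ_{y′} x·𝟙[bt x = y] = Σ_x ψ_y x·𝟙[bt x = y′]`
  rw [show ∑ x, (if siteOf d s (blk n (windowMap d ((n + 1) * s) x)) = y then (1 : ℝ) else 0) * ψ y' x
      = ∑ x, ψ y' x * (if siteOf d s (blk n (windowMap d ((n + 1) * s) x)) = y then (1 : ℝ) else 0) from
      Finset.sum_congr rfl fun x _ => mul_comm _ _,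
    show ∑ x, (if siteOf d s (blk n (windowMap d ((n + 1) * s) x)) = y' then (1 : ℝ) else 0) * ψ y x
      = ∑ x, ψ y x * (if siteOf d s (blk n (windowMap d ((n + 1) * s) x)) = y' then (1 : ℝ) else 0) from
      Finset.sum_congr rfl fun x _ => mul_comm _ _]
  exact h

include ha hκ0 hκ1 hm hV hψ in
/-- **THE BLOCK `ℓ²` NORMS OF `ψ_{y′}` DECAY AWAY FROM THE BLOCK `y′`**:
`Σ_z ψ_{y′}(σ(chart n (wm y) z))² ≤ m_κ⁻²·(n+1)^d·e^{4dκ}·e^{−2κρ_s(y,y′)}` — (131)'s weighted resolvent letter with the weight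
`(κ∕(n+1))·ρ_N(·, corner of y′)`, the source `𝟙[bt · = y′]` having weighted norm `≤ (n+1)^{d∕2}e^{dκ}`. [folklore] -/
theorem schur_column_sq_le (y y' : Site d s) :
    ∑ z : Fin d → Fin (n + 1), ψ y' (siteOf d ((n + 1) * s) (chart n (windowMap d s y) z)) ^ 2
      ≤ ((min 2 a - lam - 2 * d * κ ^ 2 - a * (exp (2 * d * κ) - 1))⁻¹) ^ 2 * ((n : ℝ) + 1) ^ d * exp (4 * d * κ)
        * exp (-(2 * κ * ∑ i, (((y i - y' i).valMinAbs.natAbs : ℕ) : ℝ))) := by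
  classical
  set m := min 2 a - lam - 2 * d * κ ^ 2 - a * (exp (2 * d * κ) - 1) with hm_def
  set c' : Site d ((n + 1) * s) := siteOf d ((n + 1) * s) (chart n (windowMap d s y') 0) with hc'
  set ρ : Site d ((n + 1) * s) → ℝ := fun x => ∑ i, (((x i - c' i).valMinAbs.natAbs : ℕ) : ℝ) with hρ_def
  have hρ : ∀ x μ, |ρ (x + siteOf d ((n + 1) * s) (e μ)) - ρ x| ≤ 1 := fun x μ => torusDist_bond_lipschitz ((n + 1) * s) x c' μ
  have hres := inverseHessian_weighted_resolvent n a s ha hκ0 hκ1 hm V hV ρ hρ (ψ y')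
    (fun x => if siteOf d s (blk n (windowMap d ((n + 1) * s) x)) = y' then 1 else 0) (hψ y')
  -- the source: weighted norm² `= Σ_z e^{2w}` over the block `y′`, `≤ (n+1)^d e^{2dκ}`
  have hsrc : ∑ x, (exp (κ / ((n : ℝ) + 1) * ρ x) * (if siteOf d s (blk n (windowMap d ((n + 1) * s) x)) = y' then (1 : ℝ) else 0)) ^ 2
      ≤ ((n : ℝ) + 1) ^ d * exp (2 * d * κ) := by
    have e1 : ∀ x, (exp (κ / ((n : ℝ) + 1) * ρ x) * (if siteOf d s (blk n (windowMap d ((n + 1) * s) x)) = y' then (1 : ℝ) else 0)) ^ 2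
        = (if siteOf d s (blk n (windowMap d ((n + 1) * s) x)) = y' then (1 : ℝ) else 0) * exp (κ / ((n : ℝ) + 1) * ρ x) ^ 2 := by
      intro x; split_ifs <;> ring
    simp only [e1]
    rw [sum_indicator_mul n s y']
    calc ∑ z : Fin d → Fin (n + 1), exp (κ / ((n : ℝ) + 1) * ρ (siteOf d ((n + 1) * s) (chart n (windowMap d s y') z))) ^ 2
        ≤ ∑ _z : Fin d → Fin (n + 1), exp (2 * d * κ) := by
          refine Finset.sum_le_sum fun z _ => ?_
          have hw := (weight_on_block n s y' y' z hκ0).2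
          rw [(SupTorusBlockDistance.isPseudoDist_torus (d := d) s).zero y', mul_zero, zero_add] at hw
          rw [← exp_nat_mul, Nat.cast_ofNat]
          exact exp_le_exp.2 (by simp only [hρ_def, hc'] at hw ⊢; linarith)
      _ = ((n : ℝ) + 1) ^ d * exp (2 * d * κ) := by rw [Finset.sum_const, Finset.card_univ, nsmul_eq_mul, card_cube]
  -- the solution on the block `y`: weights `≥ e^{κρ_s − dκ}`
  have hsol : exp (2 * (κ * (∑ i, (((y i - y' i).valMinAbs.natAbs : ℕ) : ℝ)) - d * κ))
        * ∑ z : Fin d → Fin (n + 1), ψ y' (siteOf d ((n + 1) * s) (chart n (windowMap d s y) z)) ^ 2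
      ≤ ∑ x, (exp (κ / ((n : ℝ) + 1) * ρ x) * ψ y' x) ^ 2 := by
    rw [Finset.mul_sum]
    refine le_trans (Finset.sum_le_sum fun z _ => ?_)
      (block_sum_le_total n s y (F := fun x => (exp (κ / ((n : ℝ) + 1) * ρ x) * ψ y' x) ^ 2) fun x => sq_nonneg _)
    have hw := (weight_on_block n s y y' z hκ0).1
    simp only [hρ_def, hc']
    rw [mul_pow, ← exp_nat_mul, Nat.cast_ofNat]
    exact mul_le_mul_of_nonneg_right (exp_le_exp.2 (by linarith)) (sq_nonneg _)
  -- combine: `e^{2(κρ_s − dκ)}·S_block ≤ ‖e^w ψ‖² ≤ m⁻²‖e^w χ‖² ≤ m⁻²(n+1)^d e^{2dκ}`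
  have hS0 : 0 ≤ ∑ x, (exp (κ / ((n : ℝ) + 1) * ρ x) * ψ y' x) ^ 2 := Finset.sum_nonneg fun _ _ => sq_nonneg _
  have hF0 : 0 ≤ ∑ x, (exp (κ / ((n : ℝ) + 1) * ρ x)
      * (if siteOf d s (blk n (windowMap d ((n + 1) * s) x)) = y' then (1 : ℝ) else 0)) ^ 2 := Finset.sum_nonneg fun _ _ => sq_nonneg _
  have hsq : ∑ x, (exp (κ / ((n : ℝ) + 1) * ρ x) * ψ y' x) ^ 2
      ≤ (m⁻¹) ^ 2 * (((n : ℝ) + 1) ^ d * exp (2 * d * κ)) := by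
    have h1 := pow_le_pow_left₀ (Real.sqrt_nonneg _) hres 2
    rw [Real.sq_sqrt hS0, mul_pow, Real.sq_sqrt hF0] at h1
    exact h1.trans (mul_le_mul_of_nonneg_left hsrc (sq_nonneg _))
  have hexp : 0 < exp (2 * (κ * (∑ i, (((y i - y' i).valMinAbs.natAbs : ℕ) : ℝ)) - d * κ)) := exp_pos _
  have key : ∑ z : Fin d → Fin (n + 1), ψ y' (siteOf d ((n + 1) * s) (chart n (windowMap d s y) z)) ^ 2
      ≤ (m⁻¹) ^ 2 * (((n : ℝ) + 1) ^ d * exp (2 * d * κ))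
        / exp (2 * (κ * (∑ i, (((y i - y' i).valMinAbs.natAbs : ℕ) : ℝ)) - d * κ)) := by
    rw [le_div_iff₀ hexp, mul_comm]
    exact hsol.trans hsq
  refine key.trans (le_of_eq ?_)
  rw [div_eq_iff hexp.ne']
  have hE : exp (4 * d * κ) * exp (-(2 * κ * ∑ i, (((y i - y' i).valMinAbs.natAbs : ℕ) : ℝ)))
      * exp (2 * (κ * (∑ i, (((y i - y' i).valMinAbs.natAbs : ℕ) : ℝ)) - d * κ)) = exp (2 * d * κ) := by
    rw [← exp_add, ← exp_add]; congr 1; ring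
  calc (m⁻¹) ^ 2 * (((n : ℝ) + 1) ^ d * exp (2 * d * κ)) = (m⁻¹) ^ 2 * ((n : ℝ) + 1) ^ d * (exp (4 * d * κ)
        * exp (-(2 * κ * ∑ i, (((y i - y' i).valMinAbs.natAbs : ℕ) : ℝ)))
        * exp (2 * (κ * (∑ i, (((y i - y' i).valMinAbs.natAbs : ℕ) : ℝ)) - d * κ))) := by rw [hE]; ring
    _ = _ := by ring

include ha hκ0 hκ1 hm hV hψ in
/-- **THE SCHUR COMPLEMENT IS EXPONENTIALLY LOCAL, MESH-FREE**: `|T(y,y′)| ≤ m_κ⁻¹·e^{2dκ}·e^{−κρ_s(y,y′)}` — block Cauchy–Schwarz on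
`schur_column_sq_le` (the factor `(n+1)^{d}` of the block volume cancels the normalisation `(n+1)^{−d}` exactly). [folklore] -/
theorem schur_entry_le (y y' : Site d s) :
    |(((n : ℝ) + 1) ^ d)⁻¹ * ∑ z : Fin d → Fin (n + 1), ψ y' (siteOf d ((n + 1) * s) (chart n (windowMap d s y) z))|
      ≤ (min 2 a - lam - 2 * d * κ ^ 2 - a * (exp (2 * d * κ) - 1))⁻¹ * exp (2 * d * κ)
        * exp (-(κ * ∑ i, (((y i - y' i).valMinAbs.natAbs : ℕ) : ℝ))) := by
  classical
  have hvol : (0 : ℝ) < ((n : ℝ) + 1) ^ d := by positivity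
  have hcol := schur_column_sq_le n a s ha hκ0 hκ1 hm V hV ψ hψ y y'
  have hCS := sq_sum_le_card_mul_sum_sq (s := (Finset.univ : Finset (Fin d → Fin (n + 1))))
    (f := fun z => ψ y' (siteOf d ((n + 1) * s) (chart n (windowMap d s y) z)))
  rw [Finset.card_univ, card_cube] at hCS
  have h4 : exp (4 * d * κ) = exp (2 * d * κ) ^ 2 := by rw [sq, ← exp_add]; ring_nf
  have h5 : exp (-(2 * κ * ∑ i, (((y i - y' i).valMinAbs.natAbs : ℕ) : ℝ)))
      = exp (-(κ * ∑ i, (((y i - y' i).valMinAbs.natAbs : ℕ) : ℝ))) ^ 2 := by rw [sq, ← exp_add]; ring_nf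
  have hbound : (∑ z : Fin d → Fin (n + 1), ψ y' (siteOf d ((n + 1) * s) (chart n (windowMap d s y) z))) ^ 2
      ≤ (((n : ℝ) + 1) ^ d * ((min 2 a - lam - 2 * d * κ ^ 2 - a * (exp (2 * d * κ) - 1))⁻¹ * exp (2 * d * κ)
          * exp (-(κ * ∑ i, (((y i - y' i).valMinAbs.natAbs : ℕ) : ℝ))))) ^ 2 := by
    refine hCS.trans ((mul_le_mul_of_nonneg_left hcol hvol.le).trans (le_of_eq ?_))
    rw [h4, h5]; ring
  have hnn : 0 ≤ ((n : ℝ) + 1) ^ d * ((min 2 a - lam - 2 * d * κ ^ 2 - a * (exp (2 * d * κ) - 1))⁻¹ * exp (2 * d * κ)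
      * exp (-(κ * ∑ i, (((y i - y' i).valMinAbs.natAbs : ℕ) : ℝ)))) := by
    have : 0 ≤ (min 2 a - lam - 2 * d * κ ^ 2 - a * (exp (2 * d * κ) - 1))⁻¹ := inv_nonneg.2 hm.le
    positivity
  have habs := abs_le_of_sq_le_sq' hbound hnn
  rw [abs_mul, abs_of_pos (inv_pos.2 hvol), ← le_div_iff₀' (inv_pos.2 hvol), div_inv_eq_mul]
  calc |∑ z : Fin d → Fin (n + 1), ψ y' (siteOf d ((n + 1) * s) (chart n (windowMap d s y) z))|
      ≤ ((n : ℝ) + 1) ^ d * ((min 2 a - lam - 2 * d * κ ^ 2 - a * (exp (2 * d * κ) - 1))⁻¹ * exp (2 * d * κ)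
          * exp (-(κ * ∑ i, (((y i - y' i).valMinAbs.natAbs : ℕ) : ℝ)))) := abs_le.2 habs
    _ = _ := by ring

end Schur

/-! ## §2. Given the COARSE FLOOR, the inverse Schur complement is exponentially local, mesh- and volume-free -/

/-- **THE INVERSE SCHUR COMPLEMENT IS EXPONENTIALLY LOCAL — GIVEN THE COARSE FLOOR.**  Fix `d`, `a ≥ 0`, `λ`, a rate `0 < κ ≤ 1` with
`m_κ = min(2,a) − λ − 2dκ² − a(e^{2dκ} − 1) > 0` and a floor `γ > 0`.  THERE ARE `c₁, δ₁ > 0` (functions of these only) such that on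
EVERY pair of tori (mesh `n`, period `s`), for EVERY potential `V ≥ −λ` and block columns `ψ_{y′}` (`Hψ_{y′} = 𝟙[bt · = y′]`), IF the
Schur complement `T(y,y′) = (n+1)^{−d}Σ_z ψ_{y′}(σ(chart (wm y) z))` has the floor `γ·Σ g² ≤ Σ_y g y·Σ_{y′} T(y,y′) g y′` (the torus
twin of [B6] (2.76) `Q′G′Q′* ≥ 2γ₀` — a HYPOTHESIS here; the tree's `B6QGQLower276.qGq_lower` is its free `ℤ^d` instance), THEN
`|T⁻¹(y,y′)| ≤ c₁e^{−δ₁ρ_s(y,y′)}` — `B4Sect5Torus.sect5Uniform_holds` via (132) `coarse_inverse_decay`.  Since the next-scale action's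
Hessian is `W″ = (n+1)^d·T⁻¹` in the road ((102): `W″[k,k′] = ⟨DΦ k, H DΦ k′⟩`), this is THE LOCALITY OF THE NEXT-SCALE HESSIAN, uniformly in
the field, the mesh and the volume, modulo the coarse floor. [folklore] -/
theorem schur_inverse_decay (a : ℝ) (ha : 0 ≤ a) {lam κ γ : ℝ} (hκ0 : 0 < κ) (hκ1 : κ ≤ 1)
    (hm : 0 < min 2 a - lam - 2 * d * κ ^ 2 - a * (exp (2 * d * κ) - 1)) (hγ : 0 < γ) :
    ∃ c₁ δ₁ : ℝ, 0 < c₁ ∧ 0 < δ₁ ∧ ∀ (n s : ℕ) [NeZero s] (V : Site d ((n + 1) * s) → ℝ), (∀ x, -lam ≤ V x) →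
      ∀ ψ : Site d s → Site d ((n + 1) * s) → ℝ,
      (∀ y' x, ((n : ℝ) + 1) ^ 2 * ∑ μ, (2 * ψ y' x - ψ y' (x + siteOf d ((n + 1) * s) (e μ)) - ψ y' (x - siteOf d ((n + 1) * s) (e μ)))
        + a / ((n : ℝ) + 1) ^ d * ∑ q ∈ B n (blk n (windowMap d ((n + 1) * s) x)), ψ y' (siteOf d ((n + 1) * s) q) + V x * ψ y' x
        = if siteOf d s (blk n (windowMap d ((n + 1) * s) x)) = y' then 1 else 0) →
      (∀ g : Site d s → ℝ, γ * ∑ y, g y ^ 2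
        ≤ ∑ y, g y * ∑ y', ((((n : ℝ) + 1) ^ d)⁻¹ * ∑ z : Fin d → Fin (n + 1), ψ y' (siteOf d ((n + 1) * s) (chart n (windowMap d s y) z))) * g y') →
      ∀ y y' : Site d s,
        |(Matrix.of fun y y' : Site d s =>
            (((n : ℝ) + 1) ^ d)⁻¹ * ∑ z : Fin d → Fin (n + 1), ψ y' (siteOf d ((n + 1) * s) (chart n (windowMap d s y) z)))⁻¹ y y'|
          ≤ c₁ * exp (-(δ₁ * ∑ i, (((y i - y' i).valMinAbs.natAbs : ℕ) : ℝ))) := by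
  have hc0 : 0 < (min 2 a - lam - 2 * d * κ ^ 2 - a * (exp (2 * d * κ) - 1))⁻¹ * exp (2 * d * κ) :=
    mul_pos (inv_pos.2 hm) (exp_pos _)
  obtain ⟨c₁, δ₁, hc₁, hδ₁, H⟩ := coarse_inverse_decay (d := d) hγ hc0 hκ0
  refine ⟨c₁, δ₁, hc₁, hδ₁, fun n s _ V hV ψ hψ hfloor y y' => H s _ ?_ y y'⟩
  refine ⟨?_, ?_, ?_⟩
  · exact Matrix.IsSymm.ext fun y y' => by simp only [Matrix.of_apply]; exact schur_symm n a s V ψ hψ y' y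
  · intro g
    have h := hfloor g
    simpa only [Matrix.mulVec, dotProduct, Matrix.of_apply] using h
  · intro y y'
    simpa only [Matrix.of_apply] using schur_entry_le n a s ha hκ0.le hκ1 hm V hV ψ hψ y y'


/-! ## §3. Toy -/

/-- Toy (`a = 1`, `λ = 0`, `κ = 1∕(8d+8)`-type data are NOT needed to state it): the quantifier shape of `schur_inverse_decay` — the
constants are chosen before the tori; here at `d = 0` every torus is a point and the floor hypothesis is the only input. -/
example (a : ℝ) (ha : 0 ≤ a) {lam κ γ : ℝ} (hκ0 : 0 < κ) (hκ1 : κ ≤ 1)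
    (hm : 0 < min 2 a - lam - 2 * (0 : ℕ) * κ ^ 2 - a * (exp (2 * (0 : ℕ) * κ) - 1)) (hγ : 0 < γ) :
    ∃ c₁ δ₁ : ℝ, 0 < c₁ ∧ 0 < δ₁ := by
  obtain ⟨c₁, δ₁, hc₁, hδ₁, -⟩ := schur_inverse_decay (d := 0) a ha hκ0 hκ1 hm hγ
  exact ⟨c₁, δ₁, hc₁, hδ₁⟩

end Summit.QuantumFields.BalabanUV.T4Continuum.NE7b.SupTorusSchurComplement
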